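import Summits.QuantumFields.YangMills.Theorems.QuantileBitPuritySectorDefs
import HarnessLib

/-!
# The good-field event of a seam sector — definition

Defs module (D-0009) for the sector route to `QuantileBitPurity.HolonomyQuantileSubQuartic` (stmt-QuantumFields-23948; memo HOME
`bc/g14-dw/SECTORS-translates.md` §1, `PLAN-PERIODIC.md` §B.1).  On the extended chain `(g, U⃗)` of the seam sector `z` (seam field `g`, slices
`U_0, …, U_n`, seam bond `U_n → g · tw_z U_0`) the GOOD-FIELD EVENT with action threshold `s` and link threshold `t` is

  `TT.goodEvent n z s t = { (g, U⃗) | every slice has Wilson action < s, every interior bond (U_i, U_{i+1}) has all links t-close in Frobenius norm,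
                                      and the SEAM pair (U_n, g · tw_z U_0) has all links t-close }`.

Its complement is `β^{-a}`-negligible in every sector by the cuts of `Theorems/QuantileBitPuritySectorGoodField.lean` (companion proof module
`QuantileBitPuritySectorGoodReduction`); on it every plaquette of every slice is within `√(2s)` of `1` and consecutive slices, the seam included, are
linkwise `t`-close — the hypotheses of the pinning lemmas (`FlatSheet.two_sub_le_polDist_of_twisted_sector`) and of every translate cost estimate.
DEFINITION ONLY (+ `Iff.rfl` unfolding).  HONEST FRAMING: fixed-lattice bookkeeping; nothing about infinite volume, the continuum limit or the Clay gap.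
References: [cite: Luscher1983, §2]; [cite: SeilerLNP1982, §3].
-/

set_option autoImplicit false

noncomputable section

open Literature.MathematicalPhysics.QuantumFieldTheory
open Literature.MathematicalPhysics.QuantumLattice

namespace Summit.QuantumFields.YangMills.Theorems.FemtoTransferGap.TT

open Summit.QuantumFields.YangMills.Theorems.FemtoTransferGap

variable {L : ℕ} [NeZero L]

/-- **The good-field event of the seam sector `z`** on `(seam field) × (slices)`: all slice actions `< s`, all interior bonds and the seam bond
`(U_n, g · tw_z U_0)` linkwise `t`-close (no link with Frobenius distance `> t`). [cite: Luscher1983, §2] -/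
def goodEvent (n : ℕ) (z : Fin 3 → Bool) (s t : ℝ) : Set ((Site 3 L → SU2) × (Fin (n + 1) → GaugeConfig 3 L SU2)) :=
  {p | (∀ i : Fin (n + 1), wilsonAction su2Rep (p.2 i) < s) ∧
    (∀ (i : Fin n) (e : Edge 3 L), frobNorm ((p.2 i.castSucc e : Matrix (Fin 2) (Fin 2) ℂ) - (p.2 i.succ e : Matrix (Fin 2) (Fin 2) ℂ)) ≤ t) ∧
    (∀ e : Edge 3 L, frobNorm ((p.2 (Fin.last n) e : Matrix (Fin 2) (Fin 2) ℂ) -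
      ((gaugeTransform p.1 (twist3 z (p.2 0))) e : Matrix (Fin 2) (Fin 2) ℂ)) ≤ t)}

/-- `goodEvent` unfolded. [folklore] -/
theorem mem_goodEvent_iff (n : ℕ) (z : Fin 3 → Bool) (s t : ℝ) (p : (Site 3 L → SU2) × (Fin (n + 1) → GaugeConfig 3 L SU2)) :
    p ∈ goodEvent n z s t ↔ (∀ i : Fin (n + 1), wilsonAction su2Rep (p.2 i) < s) ∧
      (∀ (i : Fin n) (e : Edge 3 L), frobNorm ((p.2 i.castSucc e : Matrix (Fin 2) (Fin 2) ℂ) - (p.2 i.succ e : Matrix (Fin 2) (Fin 2) ℂ)) ≤ t) ∧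
      (∀ e : Edge 3 L, frobNorm ((p.2 (Fin.last n) e : Matrix (Fin 2) (Fin 2) ℂ) -
        ((gaugeTransform p.1 (twist3 z (p.2 0))) e : Matrix (Fin 2) (Fin 2) ℂ)) ≤ t) := Iff.rfl

end Summit.QuantumFields.YangMills.Theorems.FemtoTransferGap.TT

end
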